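import Literature.NumberTheory.Irrationality.FischlerSprangZudilin2019.Lemma3Limit
import HarnessLib

/-!
# Fischler–Sprang–Zudilin 2019, §4 Lemma 3 — part 4: `r_{n,j'}/r_{n,j} → 1`, and Lemma 3 / Theorem 2 PROVED

Topic `Literature/NumberTheory/Irrationality/FischlerSprangZudilin2019`, namespace
`Literature.NumberTheory.Irrationality.FischlerSprangZudilin2019` (helpers in `….Lemma3`). Source: S. Fischler,
J. Sprang, W. Zudilin, *Many odd zeta values are irrational*, Compositio Math. **155** (2019) 938–952 =
arXiv:1803.08905 [FischlerSprangZudilin2019], §4 proof of Lemma 3 (held: `paper:arxiv-1803.08905`, arXiv text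
p. 8, read on the page). Last of four files PROVING the tree's named fact `lemma3` (`Asymptotics.lean`):
**`lemma3_holds : lemma3`** — Lemma 3 AS PRINTED (both limits of (4.2) and the bound `g(x₀) < 3^{-(s+1)}`).
(Theorem 2 of the source is already a theorem of the tree by a different, cruder route — `TheoremTwo.lean`,
`manyOddZetaValuesIrrational_holds`; the tree's `manyOddZetaValuesIrrational_of_lemma3` (`EliminationProof.lean`)
applied to `lemma3_holds` gives the printed route. Remark 3 is `Remark3RateBoundProofs.remark3_holds`.) No named
facts here.

## The source, verbatim (the steps formalised here)
"Combining Eqs. (4.4), (4.5), (4.6) and (4.7) we obtain `(1-3ε) r_{n,j} ≤ ∑_{(x₀-3ε)n ≤ k ≤ (x₀+3ε)n} c_{k,j} ≤ r_{n,j}`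
(4.8). … To establish `lim_{n→∞} r_{n,j'}/r_{n,j} = 1` for any `j, j' ∈ {1,…,D}`, we can assume that
`1 ≤ j ≤ D-1` and `j' = j+1`. For any `k` we have
`c_{k,j+1}/c_{k,j} = (k+3D+(j+1)/D)/(k+j/D) · (Γ(n+k+(j+1)/D)/Γ(n+k+j/D) · Γ(2n+k+1+j/D)/Γ(2n+k+1+(j+1)/D))^{s+1}`.
It follows from the Stirling formula that `Γ(x+1/D) ∼ x^{1/D} Γ(x)` as `x → ∞`, so that for `k = ⌊x₀n⌋` we have,
as `n → ∞`, `c_{k,j+1}/c_{k,j} ∼ (x₀+3)/x₀ ((x₀+1)^{1/D}/(x₀+2)^{1/D})^{s+1} = f(x₀)^{1/D} = 1`. More generally,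
for `k` in the range `(x₀-3ε)n ≤ k ≤ (x₀+3ε)n` and `n` sufficiently large we have
`1 - h̃(ε) ≤ c_{k,j+1}/c_{k,j} ≤ 1 + h̃(ε)` with `lim_{ε→0⁺} h̃(ε) = 0`. Using Eq. (4.8) this concludes the proof
of (4.2)."

## What is proved here (and the deviation from print)
* `ratio_pow_bounds`: with `ρ = c_{k,j+1}/c_{k,j}` (an exact telescoping product, `cR_succ_eq`),
  `((k+3n)/(k+1))^D ((n+k-1)/(2n+k))^{s+1} ≤ ρ^D ≤ ((k+3n+2)/k)^D ((n+k+2)/(2n+k+3))^{s+1}` — DEVIATION: the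
  `D`-th power and the elementary bounds `1 - t ≤ e^{-t}`, `1/(1+t) ≥ e^{-t}` with harmonic sums against
  logarithms replace `Γ(x+1/D) ∼ x^{1/D}Γ(x)`; only natural powers occur, and `|ρ - 1| ≤ |ρ^D - 1|`.
* `window_ratio`: uniformly for `k` in the window `(x₀-δ)n ≤ k ≤ (x₀+δ)n` and `n` large, `|ρ - 1| ≤ ε`
  (monotonicity in `k` reduces to the two endpoint sequences, whose limits tend to `f(x₀) = 1` as `δ → 0`).
* `tendsto_ratio_succ`, `tendsto_ratio`: the off-window part of `r_{n,j}` is exponentially negligible (strict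
  maximum of `L` at `x₀`, `Lemma3Profile.Lprof_gap`, and the tail (4.7)), which is (4.8); hence
  `r_{n,j'}/r_{n,j} → 1`.
* **`lemma3_holds`** (with the explicit constant `C₀ = 100`).

Cell zeta5-irr (rung F-Z1): a COUNTING theorem about `ζ(3), …, ζ(s)` for large `s`; nothing here bears on `ζ(5)`.
-/

noncomputable section

open Finset Filter Set

open scoped Nat Topology

namespace Literature.NumberTheory.Irrationality.FischlerSprangZudilin2019

namespace Lemma3

/-! ### Harmonic sums against logarithms -/

/-- `log((m+N)/m) ≤ ∑_{ℓ<N} 1/(m+ℓ)` (`m > 0`). [cite: FischlerSprangZudilin2019, §4 proof of Lemma 3 ("Γ(x+1/D) ∼ x^{1/D}Γ(x)", elementary form)] -/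
theorem log_le_sum_inv {m : ℝ} (hm : 0 < m) (N : ℕ) :
    Real.log ((m + N) / m) ≤ ∑ ℓ ∈ range N, 1 / (m + ℓ) := by
  have key : ∀ ℓ : ℕ, Real.log (m + ((ℓ + 1 : ℕ) : ℝ)) - Real.log (m + ℓ) ≤ 1 / (m + ℓ) := by
    intro ℓ
    have hpos : 0 < m + ℓ := by positivity
    rw [← Real.log_div (by positivity) hpos.ne']
    have := Real.log_le_sub_one_of_pos (show 0 < (m + ((ℓ + 1 : ℕ) : ℝ)) / (m + ℓ) by positivity)
    calc _ ≤ (m + ((ℓ + 1 : ℕ) : ℝ)) / (m + ℓ) - 1 := this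
      _ = 1 / (m + ℓ) := by push_cast; field_simp; ring
  calc Real.log ((m + N) / m) = Real.log (m + N) - Real.log m := Real.log_div (by positivity) hm.ne'
    _ = ∑ ℓ ∈ range N, (Real.log (m + ((ℓ + 1 : ℕ) : ℝ)) - Real.log (m + ℓ)) := by
        rw [Finset.sum_range_sub (fun ℓ => Real.log (m + ℓ))]
        simp
    _ ≤ ∑ ℓ ∈ range N, 1 / (m + ℓ) := sum_le_sum fun ℓ _ => key ℓ

/-- `∑_{ℓ<N} 1/(m+ℓ) ≤ log((m+N-1)/(m-1))` (`m > 1`). [cite: FischlerSprangZudilin2019, §4 proof of Lemma 3 ("Γ(x+1/D) ∼ x^{1/D}Γ(x)", elementary form)] -/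
theorem sum_inv_le_log {m : ℝ} (hm : 1 < m) (N : ℕ) :
    ∑ ℓ ∈ range N, 1 / (m + ℓ) ≤ Real.log ((m + N - 1) / (m - 1)) := by
  have key : ∀ ℓ : ℕ, 1 / (m + ℓ) ≤ Real.log (m - 1 + ((ℓ + 1 : ℕ) : ℝ)) - Real.log (m - 1 + ℓ) := by
    intro ℓ
    have hℓ0 : (0 : ℝ) ≤ ℓ := Nat.cast_nonneg ℓ
    have hpos : 0 < m - 1 + ℓ := by linarith
    have hpos' : 0 < m + ℓ := by linarith
    have e : (m - 1 + ((ℓ + 1 : ℕ) : ℝ)) = m + ℓ := by push_cast; ring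
    rw [e, ← Real.log_div hpos'.ne' hpos.ne']
    have := Real.one_sub_inv_le_log_of_pos (show 0 < (m + ℓ) / (m - 1 + ℓ) by positivity)
    calc 1 / (m + ℓ) = 1 - ((m + ℓ) / (m - 1 + ℓ))⁻¹ := by
          rw [inv_div]
          field_simp
          ring
      _ ≤ _ := this
  calc ∑ ℓ ∈ range N, 1 / (m + ℓ)
      ≤ ∑ ℓ ∈ range N, (Real.log (m - 1 + ((ℓ + 1 : ℕ) : ℝ)) - Real.log (m - 1 + ℓ)) :=
        sum_le_sum fun ℓ _ => key ℓ
    _ = Real.log (m - 1 + N) - Real.log (m - 1) := by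
        rw [Finset.sum_range_sub (fun ℓ => Real.log (m - 1 + ℓ))]
        simp
    _ = Real.log ((m + N - 1) / (m - 1)) := by
        have hN0 : (0 : ℝ) ≤ N := Nat.cast_nonneg N
        rw [Real.log_div (by linarith) (by linarith)]
        ring_nf

/-! ### The ratio `c_{k,j+1}/c_{k,j}` -/

/-- **The ratio is a telescoping product**:
`c_{k,j+1} = c_{k,j} · (k+(j+3Dn+1)/D)/(k+j/D) · ∏_{ℓ ≤ n} ((n+k+j/D+ℓ)/(n+k+j/D+ℓ+1/D))^{s+1}`.
[cite: FischlerSprangZudilin2019, §4 proof of Lemma 3 (formula for c_{k,j+1}/c_{k,j})] -/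
theorem cR_succ_eq {s D n j : ℕ} (hn : 1 ≤ n) (hj : 1 ≤ j) (hjD : j + 1 ≤ D) (k : ℕ) :
    cR s D n (j + 1) k = cR s D n j k *
      ((((k : ℝ) + ((j : ℝ) + (3 * D * n + 1 : ℕ)) / D) / ((k : ℝ) + (j : ℝ) / D)) *
        (∏ ℓ ∈ range (n + 1), (((n : ℝ) + k + (j : ℝ) / D + ℓ) / ((n : ℝ) + k + (j : ℝ) / D + ℓ + 1 / D))) ^ (s + 1)) := by
  have hD : (0 : ℝ) < D := by exact_mod_cast (show 0 < D by omega)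
  have hjD1 : j ≤ D := by omega
  set u : ℕ → ℝ := fun ℓ => (k : ℝ) + ((j : ℝ) + ℓ) / D with hu
  set v : ℕ → ℝ := fun ℓ => (n : ℝ) + k + (j : ℝ) / D + ℓ with hv
  have hu_pos : ∀ ℓ, 0 < u ℓ := fun ℓ => num_factor_pos hj hjD1 k ℓ
  have hv_pos : ∀ ℓ, 0 < v ℓ := fun ℓ => by
    have := one_le_den_factor (D := D) (j := j) hn k ℓ
    rw [hv]; linarith
  -- numerator: P(j+1) * u 0 = P(j) * u N
  have hP : (∏ ℓ ∈ range (3 * D * n + 1), ((k : ℝ) + (((j + 1 : ℕ) : ℝ) + ℓ) / D)) * u 0 =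
      (∏ ℓ ∈ range (3 * D * n + 1), u ℓ) * u (3 * D * n + 1) := by
    have e1 : (∏ ℓ ∈ range (3 * D * n + 1), ((k : ℝ) + (((j + 1 : ℕ) : ℝ) + ℓ) / D)) =
        ∏ ℓ ∈ range (3 * D * n + 1), u (ℓ + 1) := by
      refine prod_congr rfl fun ℓ _ => ?_
      rw [hu]
      push_cast
      ring
    rw [e1, ← prod_range_succ', prod_range_succ]
  -- denominator: Q(j+1) factors are v ℓ + 1/D
  have hQ : (∏ ℓ ∈ range (n + 1), ((n : ℝ) + k + (((j + 1 : ℕ) : ℝ)) / D + ℓ)) =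
      ∏ ℓ ∈ range (n + 1), (v ℓ + 1 / D) := by
    refine prod_congr rfl fun ℓ _ => ?_
    rw [hv]
    push_cast
    ring
  have hPj : 0 < ∏ ℓ ∈ range (3 * D * n + 1), u ℓ := prod_pos fun ℓ _ => hu_pos ℓ
  have hQj : 0 < ∏ ℓ ∈ range (n + 1), v ℓ := prod_pos fun ℓ _ => hv_pos ℓ
  have hQj1 : 0 < ∏ ℓ ∈ range (n + 1), (v ℓ + 1 / D) := prod_pos fun ℓ _ => by
    have := hv_pos ℓ; positivity
  unfold cR
  rw [hQ, prod_div_distrib, div_pow]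
  have hP' : (∏ ℓ ∈ range (3 * D * n + 1), ((k : ℝ) + (((j + 1 : ℕ) : ℝ) + ℓ) / D)) =
      (∏ ℓ ∈ range (3 * D * n + 1), u ℓ) * u (3 * D * n + 1) / u 0 := by
    rw [eq_div_iff (hu_pos 0).ne', hP]
  rw [hP']
  have h0 := (hu_pos 0).ne'
  have hN := (hu_pos (3 * D * n + 1)).ne'
  simp only [hu, hv, Nat.cast_zero, add_zero] at h0 hN hPj hQj hQj1 ⊢
  field_simp

/-- `|ρ - 1| ≤ ε` from `1 - ε ≤ ρ^D ≤ 1 + ε` (`ρ > 0`, `D ≥ 1`).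
[cite: FischlerSprangZudilin2019, §4 proof of Lemma 3 ("= f(x₀)^{1/D} = 1")] -/
theorem abs_sub_one_le_of_pow {ρ ε : ℝ} {D : ℕ} (hρ : 0 < ρ) (hD : 1 ≤ D)
    (h1 : 1 - ε ≤ ρ ^ D) (h2 : ρ ^ D ≤ 1 + ε) : |ρ - 1| ≤ ε := by
  rw [abs_le]
  rcases le_or_gt ρ 1 with h | h
  · have : ρ ^ D ≤ ρ := pow_le_of_le_one hρ.le h (by omega)
    constructor <;> nlinarith
  · have : ρ ≤ ρ ^ D := le_self_pow₀ h.le (by omega)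
    constructor <;> nlinarith

/-- **Two-sided bounds for `ρ^D`, `ρ = c_{k,j+1}/c_{k,j}`** (`n ≥ 1`, `k ≥ 1`, `1 ≤ j < D`):
`((k+3n)/(k+1))^D ((n+k-1)/(2n+k))^{s+1} ≤ ρ^D ≤ ((k+3n+2)/k)^D ((n+k+2)/(2n+k+3))^{s+1}`.
[cite: FischlerSprangZudilin2019, §4 proof of Lemma 3 ("1 - h̃(ε) ≤ c_{k,j+1}/c_{k,j} ≤ 1 + h̃(ε)")] -/
theorem ratio_pow_bounds {s D n j k : ℕ} (hn : 1 ≤ n) (hk : 1 ≤ k) (hj : 1 ≤ j) (hjD : j + 1 ≤ D) :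
    (((k : ℝ) + 3 * n) / ((k : ℝ) + 1)) ^ D * ((((n : ℝ) + k - 1) / (2 * (n : ℝ) + k))) ^ (s + 1) ≤
        (cR s D n (j + 1) k / cR s D n j k) ^ D ∧
      (cR s D n (j + 1) k / cR s D n j k) ^ D ≤
        (((k : ℝ) + 3 * n + 2) / (k : ℝ)) ^ D * ((((n : ℝ) + k + 2) / (2 * (n : ℝ) + k + 3))) ^ (s + 1) := by
  have hD1 : 1 ≤ D := by omega
  have hD : (0 : ℝ) < D := by exact_mod_cast (show 0 < D by omega)
  have hD' : (1 : ℝ) ≤ D := by exact_mod_cast hD1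
  have hjD1 : j ≤ D := by omega
  have hn' : (1 : ℝ) ≤ n := by exact_mod_cast hn
  have hk' : (1 : ℝ) ≤ k := by exact_mod_cast hk
  have hj' : (1 : ℝ) ≤ j := by exact_mod_cast hj
  have hjD' : (j : ℝ) + 1 ≤ D := by exact_mod_cast hjD
  have hc := cR_pos (s := s) hn hj hjD1 k
  -- the ratio
  set T₁ : ℝ := (((k : ℝ) + ((j : ℝ) + (3 * D * n + 1 : ℕ)) / D) / ((k : ℝ) + (j : ℝ) / D)) with hT₁
  set v : ℕ → ℝ := fun ℓ => (n : ℝ) + k + (j : ℝ) / D + ℓ with hv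
  set T₂ : ℝ := ∏ ℓ ∈ range (n + 1), (v ℓ / (v ℓ + 1 / D)) with hT₂
  have hρ : cR s D n (j + 1) k / cR s D n j k = T₁ * T₂ ^ (s + 1) := by
    rw [cR_succ_eq hn hj hjD k, mul_div_cancel_left₀ _ hc.ne']
  have hv1 : ∀ ℓ : ℕ, (n : ℝ) + k + ℓ ≤ v ℓ := fun ℓ => by
    have h0 : (0 : ℝ) ≤ (j : ℝ) / D := by positivity
    show (n : ℝ) + k + ℓ ≤ (n : ℝ) + k + (j : ℝ) / D + ℓ
    linarith
  have hv2 : ∀ ℓ : ℕ, v ℓ + 1 / D ≤ (n : ℝ) + k + 2 + ℓ := fun ℓ => by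
    have h1 : ((j : ℝ) + 1) / D ≤ 1 := by rw [div_le_one hD]; exact hjD'
    have e : (j : ℝ) / D + 1 / D = ((j : ℝ) + 1) / D := by ring
    show (n : ℝ) + k + (j : ℝ) / D + ℓ + 1 / D ≤ (n : ℝ) + k + 2 + ℓ
    linarith
  have hvpos : ∀ ℓ : ℕ, 0 < v ℓ := fun ℓ => by
    have h1 := hv1 ℓ
    have h2 : (0 : ℝ) ≤ ℓ := Nat.cast_nonneg ℓ
    linarith
  -- T₁ bounds
  have hT₁u : T₁ ≤ ((k : ℝ) + 3 * n + 2) / k := by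
    rw [hT₁, div_le_div_iff₀ (by positivity) (by positivity)]
    push_cast
    have h1 : ((j : ℝ) + (3 * D * n + 1)) / D ≤ 3 * n + 2 := by
      rw [div_le_iff₀ hD]; nlinarith
    have h2 : (0 : ℝ) ≤ (j : ℝ) / D := by positivity
    have h3 : 0 ≤ ((j : ℝ) + (3 * D * n + 1)) / D := by positivity
    nlinarith [mul_nonneg h2 (by positivity : (0 : ℝ) ≤ (k : ℝ) + 3 * n + 2)]
  have hT₁l : ((k : ℝ) + 3 * n) / ((k : ℝ) + 1) ≤ T₁ := by
    rw [hT₁, div_le_div_iff₀ (by positivity) (by positivity)]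
    push_cast
    have h1 : 3 * (n : ℝ) ≤ ((j : ℝ) + (3 * D * n + 1)) / D := by
      rw [le_div_iff₀ hD]; nlinarith
    have h2 : (j : ℝ) / D ≤ 1 := by rw [div_le_one hD]; linarith
    have h3 : (0 : ℝ) ≤ (j : ℝ) / D := by positivity
    nlinarith [mul_nonneg h3 (by positivity : (0 : ℝ) ≤ (k : ℝ) + 3 * n)]
  have hT₁pos : 0 < T₁ := lt_of_lt_of_le (by positivity) hT₁l
  -- T₂^D bounds
  have hT₂pos : 0 < T₂ := by rw [hT₂]; exact prod_pos fun ℓ _ => by have := hvpos ℓ; positivity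
  have hT₂u : T₂ ^ D ≤ ((n : ℝ) + k + 2) / (2 * (n : ℝ) + k + 3) := by
    -- each factor ≤ exp(-(1/D)/(v+1/D))
    have hfac : ∀ ℓ ∈ range (n + 1), v ℓ / (v ℓ + 1 / D) ≤ Real.exp (-((1 / D) / (v ℓ + 1 / D))) := by
      intro ℓ _
      have hw : v ℓ / (v ℓ + 1 / D) = -((1 / D) / (v ℓ + 1 / D)) + 1 := by
        have := hvpos ℓ; field_simp; ring
      rw [hw]
      exact Real.add_one_le_exp _
    have h1 : T₂ ≤ Real.exp (-(1 / D) * ∑ ℓ ∈ range (n + 1), 1 / (v ℓ + 1 / D)) := by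
      rw [hT₂, mul_sum, Real.exp_sum]
      refine prod_le_prod (fun ℓ _ => by have := hvpos ℓ; positivity) fun ℓ hℓ => ?_
      rw [show -(1 / (D : ℝ)) * (1 / (v ℓ + 1 / D)) = -((1 / D) / (v ℓ + 1 / D)) by ring]
      exact hfac ℓ hℓ
    have h2 : T₂ ^ D ≤ Real.exp (-∑ ℓ ∈ range (n + 1), 1 / (v ℓ + 1 / D)) := by
      calc T₂ ^ D ≤ (Real.exp (-(1 / D) * ∑ ℓ ∈ range (n + 1), 1 / (v ℓ + 1 / D))) ^ D :=
            pow_le_pow_left₀ hT₂pos.le h1 D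
        _ = _ := by rw [← Real.exp_nat_mul]; congr 1; field_simp
    have h3 : Real.log ((((n : ℝ) + k + 2) + (n + 1 : ℕ)) / ((n : ℝ) + k + 2)) ≤
        ∑ ℓ ∈ range (n + 1), 1 / (v ℓ + 1 / D) :=
      (log_le_sum_inv (m := (n : ℝ) + k + 2) (by positivity) (n + 1)).trans
        (sum_le_sum fun ℓ _ => one_div_le_one_div_of_le (by have := hvpos ℓ; positivity) (hv2 ℓ))
    calc T₂ ^ D ≤ Real.exp (-∑ ℓ ∈ range (n + 1), 1 / (v ℓ + 1 / D)) := h2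
      _ ≤ Real.exp (-Real.log ((((n : ℝ) + k + 2) + (n + 1 : ℕ)) / ((n : ℝ) + k + 2))) :=
          Real.exp_le_exp.2 (neg_le_neg h3)
      _ = ((n : ℝ) + k + 2) / (2 * (n : ℝ) + k + 3) := by
          rw [Real.exp_neg, Real.exp_log (by positivity), inv_div]
          push_cast
          ring_nf
  have hT₂l : ((n : ℝ) + k - 1) / (2 * (n : ℝ) + k) ≤ T₂ ^ D := by
    have hfac : ∀ ℓ ∈ range (n + 1), Real.exp (-((1 / D) / v ℓ)) ≤ v ℓ / (v ℓ + 1 / D) := by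
      intro ℓ _
      have hvl := hvpos ℓ
      have hw : v ℓ / (v ℓ + 1 / D) = 1 / (((1 / D) / v ℓ) + 1) := by
        field_simp
        ring
      rw [hw, Real.exp_neg, ← one_div]
      exact one_div_le_one_div_of_le (by positivity) (Real.add_one_le_exp _)
    have h1 : Real.exp (-(1 / D) * ∑ ℓ ∈ range (n + 1), 1 / v ℓ) ≤ T₂ := by
      rw [hT₂, mul_sum, Real.exp_sum]
      refine prod_le_prod (fun ℓ _ => (Real.exp_pos _).le) fun ℓ hℓ => ?_
      rw [show -(1 / (D : ℝ)) * (1 / v ℓ) = -((1 / D) / v ℓ) by ring]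
      exact hfac ℓ hℓ
    have h2 : Real.exp (-∑ ℓ ∈ range (n + 1), 1 / v ℓ) ≤ T₂ ^ D := by
      calc Real.exp (-∑ ℓ ∈ range (n + 1), 1 / v ℓ)
          = (Real.exp (-(1 / D) * ∑ ℓ ∈ range (n + 1), 1 / v ℓ)) ^ D := by
            rw [← Real.exp_nat_mul]; congr 1; field_simp
        _ ≤ T₂ ^ D := pow_le_pow_left₀ (Real.exp_pos _).le h1 D
    have hm : (1 : ℝ) < (n : ℝ) + k := by linarith
    have h3 : ∑ ℓ ∈ range (n + 1), 1 / v ℓ ≤ Real.log ((((n : ℝ) + k) + (n + 1 : ℕ) - 1) / (((n : ℝ) + k) - 1)) :=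
      (sum_le_sum fun ℓ _ => one_div_le_one_div_of_le
        (by have h0 : (0 : ℝ) ≤ ℓ := Nat.cast_nonneg ℓ; linarith) (hv1 ℓ)).trans
        (sum_inv_le_log hm (n + 1))
    calc ((n : ℝ) + k - 1) / (2 * (n : ℝ) + k)
        = Real.exp (-Real.log ((((n : ℝ) + k) + (n + 1 : ℕ) - 1) / (((n : ℝ) + k) - 1))) := by
          rw [Real.exp_neg, Real.exp_log (by push_cast; exact div_pos (by linarith) (by linarith)), inv_div]
          push_cast
          ring_nf
      _ ≤ Real.exp (-∑ ℓ ∈ range (n + 1), 1 / v ℓ) := Real.exp_le_exp.2 (neg_le_neg h3)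
      _ ≤ T₂ ^ D := h2
  -- assemble
  rw [hρ, mul_pow, ← pow_mul, mul_comm (s + 1) D, pow_mul]
  have hT₂D : 0 ≤ T₂ ^ D := by positivity
  have hlow0 : 0 ≤ ((n : ℝ) + k - 1) / (2 * (n : ℝ) + k) := by
    apply div_nonneg <;> linarith
  constructor
  · exact mul_le_mul (pow_le_pow_left₀ (by positivity) hT₁l D) (pow_le_pow_left₀ hlow0 hT₂l _)
      (by positivity) (by positivity)
  · exact mul_le_mul (pow_le_pow_left₀ hT₁pos.le hT₁u D) (pow_le_pow_left₀ hT₂D hT₂u _)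
      (by positivity) (by positivity)

/-! ### The window `(x₀-δ)n ≤ k ≤ (x₀+δ)n`: uniform bounds via monotonicity in `k` -/

/-- Generic limit: `(1+α)^D (1-β)^{s+1}` is continuous in `(α, β)`.
[cite: FischlerSprangZudilin2019, §4 proof of Lemma 3 ("lim_{ε→0⁺} h̃(ε) = 0")] -/
theorem tendsto_one_add_pow_mul {ι : Type*} {l : Filter ι} {α β : ι → ℝ} {a b : ℝ} (s D : ℕ)
    (hα : Tendsto α l (𝓝 a)) (hβ : Tendsto β l (𝓝 b)) :
    Tendsto (fun i => (1 + α i) ^ D * (1 - β i) ^ (s + 1)) l (𝓝 ((1 + a) ^ D * (1 - b) ^ (s + 1))) :=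
  ((tendsto_const_nhds.add hα).pow D).mul ((tendsto_const_nhds.sub hβ).pow (s + 1))

/-- `(1 + 3/x)^D (1 - 1/(2+x))^{s+1} = f(x)` (`x > 0`). [cite: FischlerSprangZudilin2019, §4 proof of Lemma 3 ("= f(x₀)^{1/D} = 1")] -/
theorem one_add_pow_mul_eq_fRatio (s D : ℕ) {x : ℝ} (hx : 0 < x) :
    (1 + 3 / x) ^ D * (1 - 1 / (2 + x)) ^ (s + 1) = fRatio s D x := by
  unfold fRatio
  congr 2
  · field_simp
  · field_simp
    ring

/-- The upper window sequence `Ū_n = (1 + (3n+2)/((x₀-δ)n))^D (1 - (n+1)/(2n+(x₀+δ)n+3))^{s+1}` tends to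
`(1 + 3/(x₀-δ))^D (1 - 1/(2+x₀+δ))^{s+1}`. [cite: FischlerSprangZudilin2019, §4 proof of Lemma 3 (window bounds)] -/
theorem tendsto_Useq (s D : ℕ) {y z : ℝ} (hy : 0 < y) (hz : 0 < z) :
    Tendsto (fun n : ℕ => (1 + (3 * (n : ℝ) + 2) / (y * n)) ^ D *
        (1 - ((n : ℝ) + 1) / (2 * n + z * n + 3)) ^ (s + 1)) atTop
      (𝓝 ((1 + 3 / y) ^ D * (1 - 1 / (2 + z)) ^ (s + 1))) := by
  have h0 : Tendsto (fun n : ℕ => (1 : ℝ) / n) atTop (𝓝 0) := tendsto_one_div_atTop_nhds_zero_nat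
  have hα : Tendsto (fun n : ℕ => (3 * (n : ℝ) + 2) / (y * n)) atTop (𝓝 (3 / y)) := by
    have h : Tendsto (fun n : ℕ => (3 + 2 * ((1 : ℝ) / n)) / y) atTop (𝓝 ((3 + 2 * 0) / y)) :=
      (tendsto_const_nhds.add (h0.const_mul 2)).div_const y
    rw [mul_zero, add_zero] at h
    refine h.congr' ?_
    filter_upwards [eventually_ge_atTop 1] with n hn
    have : (0 : ℝ) < n := by exact_mod_cast hn
    field_simp
  have hβ : Tendsto (fun n : ℕ => ((n : ℝ) + 1) / (2 * n + z * n + 3)) atTop (𝓝 (1 / (2 + z))) := by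
    have h : Tendsto (fun n : ℕ => (1 + (1 : ℝ) / n) / (2 + z + 3 * ((1 : ℝ) / n))) atTop
        (𝓝 ((1 + 0) / (2 + z + 3 * 0))) :=
      (tendsto_const_nhds.add h0).div (tendsto_const_nhds.add (h0.const_mul 3)) (by linarith)
    rw [add_zero, mul_zero, add_zero] at h
    refine h.congr' ?_
    filter_upwards [eventually_ge_atTop 1] with n hn
    have : (0 : ℝ) < n := by exact_mod_cast hn
    field_simp
  exact tendsto_one_add_pow_mul s D hα hβ

/-- The lower window sequence `V̄_n = (1 + (3n-1)/((x₀+δ)n+1))^D (1 - (n+1)/(2n+(x₀-δ)n))^{s+1}` tends to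
`(1 + 3/(x₀+δ))^D (1 - 1/(2+x₀-δ))^{s+1}`. [cite: FischlerSprangZudilin2019, §4 proof of Lemma 3 (window bounds)] -/
theorem tendsto_Vseq (s D : ℕ) {y z : ℝ} (hy : 0 < y) (hz : 0 < z) :
    Tendsto (fun n : ℕ => (1 + (3 * (n : ℝ) - 1) / (y * n + 1)) ^ D *
        (1 - ((n : ℝ) + 1) / (2 * n + z * n)) ^ (s + 1)) atTop
      (𝓝 ((1 + 3 / y) ^ D * (1 - 1 / (2 + z)) ^ (s + 1))) := by
  have h0 : Tendsto (fun n : ℕ => (1 : ℝ) / n) atTop (𝓝 0) := tendsto_one_div_atTop_nhds_zero_nat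
  have hα : Tendsto (fun n : ℕ => (3 * (n : ℝ) - 1) / (y * n + 1)) atTop (𝓝 (3 / y)) := by
    have h : Tendsto (fun n : ℕ => (3 - (1 : ℝ) / n) / (y + (1 : ℝ) / n)) atTop (𝓝 ((3 - 0) / (y + 0))) :=
      (tendsto_const_nhds.sub h0).div (tendsto_const_nhds.add h0) (by linarith)
    rw [sub_zero, add_zero] at h
    refine h.congr' ?_
    filter_upwards [eventually_ge_atTop 1] with n hn
    have : (0 : ℝ) < n := by exact_mod_cast hn
    field_simp
  have hβ : Tendsto (fun n : ℕ => ((n : ℝ) + 1) / (2 * n + z * n)) atTop (𝓝 (1 / (2 + z))) := by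
    have h : Tendsto (fun n : ℕ => (1 + (1 : ℝ) / n) / (2 + z)) atTop (𝓝 ((1 + 0) / (2 + z))) :=
      (tendsto_const_nhds.add h0).div_const _
    rw [add_zero] at h
    refine h.congr' ?_
    filter_upwards [eventually_ge_atTop 1] with n hn
    have : (0 : ℝ) < n := by exact_mod_cast hn
    field_simp
  exact tendsto_one_add_pow_mul s D hα hβ

/-- As `δ → 0`, `(1 + 3/(x₀∓δ))^D (1 - 1/(2+x₀±δ))^{s+1} → f(x₀)`.
[cite: FischlerSprangZudilin2019, §4 proof of Lemma 3 ("lim_{ε→0⁺} h̃(ε) = 0")] -/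
theorem tendsto_window_limit (s D : ℕ) {x₀ : ℝ} (hx₀ : 0 < x₀) (σ : ℝ) :
    Tendsto (fun δ : ℝ => (1 + 3 / (x₀ - σ * δ)) ^ D * (1 - 1 / (2 + (x₀ + σ * δ))) ^ (s + 1)) (𝓝 0)
      (𝓝 (fRatio s D x₀)) := by
  have h1 : Tendsto (fun δ : ℝ => x₀ - σ * δ) (𝓝 0) (𝓝 x₀) := by
    have : Tendsto (fun δ : ℝ => x₀ - σ * δ) (𝓝 0) (𝓝 (x₀ - σ * 0)) :=
      tendsto_const_nhds.sub (tendsto_id.const_mul σ)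
    simpa using this
  have h2 : Tendsto (fun δ : ℝ => x₀ + σ * δ) (𝓝 0) (𝓝 x₀) := by
    have : Tendsto (fun δ : ℝ => x₀ + σ * δ) (𝓝 0) (𝓝 (x₀ + σ * 0)) :=
      tendsto_const_nhds.add (tendsto_id.const_mul σ)
    simpa using this
  have hα : Tendsto (fun δ : ℝ => 3 / (x₀ - σ * δ)) (𝓝 0) (𝓝 (3 / x₀)) := tendsto_const_nhds.div h1 hx₀.ne'
  have hβ : Tendsto (fun δ : ℝ => 1 / (2 + (x₀ + σ * δ))) (𝓝 0) (𝓝 (1 / (2 + x₀))) :=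
    tendsto_const_nhds.div (tendsto_const_nhds.add h2) (by linarith)
  have := tendsto_one_add_pow_mul s D hα hβ
  rwa [one_add_pow_mul_eq_fRatio s D hx₀] at this

/-- **Uniform in-window estimate**: for every `ε > 0` there are `δ > 0` (`δ ≤ x₀/2`, `δ ≤ 1/2`) and `N` with
`|c_{k,j+1}/c_{k,j} - 1| ≤ ε` for all `n ≥ N`, all `k` with `(x₀-δ)n ≤ k ≤ (x₀+δ)n`, all `1 ≤ j < D`.
[cite: FischlerSprangZudilin2019, §4 proof of Lemma 3 ("for k in the range (x₀-3ε)n ≤ k ≤ (x₀+3ε)n and n sufficiently large we have 1 - h̃(ε) ≤ c_{k,j+1}/c_{k,j} ≤ 1 + h̃(ε)")] -/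
theorem window_ratio {s D : ℕ} (hD : 1 ≤ D) {x₀ : ℝ} (hx₀ : 0 < x₀) (hf1 : fRatio s D x₀ = 1)
    {ε : ℝ} (hε : 0 < ε) :
    ∃ δ : ℝ, 0 < δ ∧ δ ≤ x₀ / 2 ∧ δ ≤ 1 / 2 ∧ ∃ N : ℕ, ∀ n : ℕ, N ≤ n → ∀ k : ℕ,
      (x₀ - δ) * n ≤ k → (k : ℝ) ≤ (x₀ + δ) * n → ∀ j : ℕ, 1 ≤ j → j + 1 ≤ D →
        |cR s D n (j + 1) k / cR s D n j k - 1| ≤ ε := by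
  -- limits in δ
  have hU0 := tendsto_window_limit s D hx₀ 1
  have hV0 := tendsto_window_limit s D hx₀ (-1)
  rw [hf1] at hU0 hV0
  have hU0' : ∀ᶠ δ : ℝ in 𝓝 0, (1 + 3 / (x₀ - 1 * δ)) ^ D * (1 - 1 / (2 + (x₀ + 1 * δ))) ^ (s + 1) < 1 + ε :=
    hU0 (Iio_mem_nhds (by linarith))
  have hV0' : ∀ᶠ δ : ℝ in 𝓝 0, 1 - ε < (1 + 3 / (x₀ - -1 * δ)) ^ D * (1 - 1 / (2 + (x₀ + -1 * δ))) ^ (s + 1) :=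
    hV0 (Ioi_mem_nhds (by linarith))
  obtain ⟨ρ, hρ, hρP⟩ := Metric.eventually_nhds_iff.1 (hU0'.and hV0')
  set δ : ℝ := min (ρ / 2) (min (x₀ / 2) (1 / 2)) with hδ
  have hδ0 : 0 < δ := lt_min (by linarith) (lt_min (by linarith) (by norm_num))
  have hδρ : δ ≤ ρ / 2 := min_le_left _ _
  have hδx : δ ≤ x₀ / 2 := (min_le_right _ _).trans (min_le_left _ _)
  have hδ1 : δ ≤ 1 / 2 := (min_le_right _ _).trans (min_le_right _ _)
  have hP := hρP (y := δ) (by rw [dist_zero_right, Real.norm_eq_abs, abs_of_pos hδ0]; linarith)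
  simp only [one_mul, neg_mul, sub_neg_eq_add] at hP
  obtain ⟨hPU, hPV⟩ := hP
  have hy1 : 0 < x₀ - δ := by linarith
  have hy2 : 0 < x₀ + δ := by linarith
  -- limits in n
  have hUn := (tendsto_Useq s D hy1 hy2).eventually (Iio_mem_nhds hPU)
  have hVn := (tendsto_Vseq s D hy2 hy1).eventually (Ioi_mem_nhds (by rw [← sub_eq_add_neg] at hPV; exact hPV))
  obtain ⟨N, hN⟩ := eventually_atTop.1 ((hUn.and hVn).and (eventually_ge_atTop 1))
  refine ⟨δ, hδ0, hδx, hδ1, N, fun n hn k hk1 hk2 j hj hjD => ?_⟩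
  obtain ⟨⟨hU, hV⟩, hn1⟩ := hN n hn
  have hn' : (1 : ℝ) ≤ n := by exact_mod_cast hn1
  have hkpos : (0 : ℝ) < k := lt_of_lt_of_le (by nlinarith) hk1
  have hk : 1 ≤ k := by exact_mod_cast hkpos
  have hk' : (1 : ℝ) ≤ k := by exact_mod_cast hk
  obtain ⟨hlow, hup⟩ := ratio_pow_bounds (s := s) hn1 hk hj hjD
  have hρpos : 0 < cR s D n (j + 1) k / cR s D n j k :=
    div_pos (cR_pos hn1 (by omega) hjD k) (cR_pos hn1 hj (by omega) k)
  refine abs_sub_one_le_of_pow hρpos hD ?_ ?_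
  · -- lower: V̄_n ≤ printed lower bound
    refine le_trans hV.le (le_trans ?_ hlow)
    have h1 : 1 + (3 * (n : ℝ) - 1) / ((x₀ + δ) * n + 1) ≤ ((k : ℝ) + 3 * n) / ((k : ℝ) + 1) := by
      rw [show ((k : ℝ) + 3 * n) / ((k : ℝ) + 1) = 1 + (3 * (n : ℝ) - 1) / ((k : ℝ) + 1) by
        field_simp; ring]
      gcongr
      · linarith
    have h2 : 1 - ((n : ℝ) + 1) / (2 * n + (x₀ - δ) * n) ≤ ((n : ℝ) + k - 1) / (2 * (n : ℝ) + k) := by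
      rw [show ((n : ℝ) + k - 1) / (2 * (n : ℝ) + k) = 1 - ((n : ℝ) + 1) / (2 * (n : ℝ) + k) by
        field_simp; ring, sub_le_sub_iff_left]
      exact div_le_div_of_nonneg_left (by positivity) (by nlinarith) (by linarith)
    have h0 : 0 ≤ 1 - ((n : ℝ) + 1) / (2 * n + (x₀ - δ) * n) := by
      rw [sub_nonneg, div_le_one (by nlinarith)]
      nlinarith
    have h1' : (0 : ℝ) ≤ 1 + (3 * (n : ℝ) - 1) / ((x₀ + δ) * n + 1) :=
      add_nonneg zero_le_one (div_nonneg (by linarith) (by positivity))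
    exact mul_le_mul (pow_le_pow_left₀ h1' h1 D) (pow_le_pow_left₀ h0 h2 _)
      (by positivity) (by positivity)
  · -- upper: printed upper bound ≤ Ū_n
    refine le_trans hup (le_trans ?_ hU.le)
    have h1 : ((k : ℝ) + 3 * n + 2) / (k : ℝ) ≤ 1 + (3 * (n : ℝ) + 2) / ((x₀ - δ) * n) := by
      rw [show ((k : ℝ) + 3 * n + 2) / (k : ℝ) = 1 + (3 * (n : ℝ) + 2) / k by field_simp; ring]
      gcongr
    have h2 : ((n : ℝ) + k + 2) / (2 * (n : ℝ) + k + 3) ≤ 1 - ((n : ℝ) + 1) / (2 * n + (x₀ + δ) * n + 3) := by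
      rw [show ((n : ℝ) + k + 2) / (2 * (n : ℝ) + k + 3) = 1 - ((n : ℝ) + 1) / (2 * (n : ℝ) + k + 3) by
        field_simp; ring, sub_le_sub_iff_left]
      exact div_le_div_of_nonneg_left (by positivity) (by positivity) (by linarith)
    exact mul_le_mul (pow_le_pow_left₀ (by positivity) h1 D) (pow_le_pow_left₀ (by positivity) h2 _)
      (by positivity) (by positivity)

/-! ### The off-window part is negligible (eq. (4.8)) -/

/-- `E · exp(n(-κ + d_n) + C(1 + log(n+1))) → 0` when `d_n → 0`, `κ > 0`.
[cite: FischlerSprangZudilin2019, §4 proof of Lemma 3, eqs. (4.5)–(4.7)] -/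
theorem tendsto_exp_form {d : ℕ → ℝ} (hd : Tendsto d atTop (𝓝 0)) {κ : ℝ} (hκ : 0 < κ) (C E : ℝ) :
    Tendsto (fun n : ℕ => E * Real.exp (n * (-κ + d n) + C * (1 + Real.log ((n : ℝ) + 1)))) atTop (𝓝 0) := by
  have hu := tendsto_one_add_log_div
  have hinner : Tendsto (fun n : ℕ => -κ + d n + C * ((1 + Real.log ((n : ℝ) + 1)) / n)) atTop (𝓝 (-κ)) := by
    simpa using (tendsto_const_nhds.add hd).add (hu.const_mul C)
  have hprod := (tendsto_natCast_atTop_atTop (R := ℝ)).atTop_mul_neg (by linarith) hinner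
  have hexp := Real.tendsto_exp_atBot.comp hprod
  have := hexp.const_mul E
  rw [mul_zero] at this
  refine this.congr' ?_
  filter_upwards [eventually_ge_atTop 1] with n hn
  have : (0 : ℝ) < n := by exact_mod_cast hn
  simp only [Function.comp_apply]
  congr 2
  field_simp

/-- `L(⌊x₀ n⌋/n) → L(x₀)`. [cite: FischlerSprangZudilin2019, §4 proof of Lemma 3 (k₀(n) = ⌊x₀ n⌋)] -/
theorem tendsto_Lprof_floor (s D : ℕ) {x₀ : ℝ} (hx₀ : 0 ≤ x₀) :
    Tendsto (fun n : ℕ => Lprof s D ((⌊x₀ * n⌋₊ : ℝ) / n)) atTop (𝓝 (Lprof s D x₀)) :=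
  ((continuous_Lprof s D).tendsto x₀).comp (tendsto_floor_div hx₀)

/-- **`r_{n,j+1}/r_{n,j} → 1`** (`D ≥ 2`, `s ≥ 3D`, `1 ≤ j < D`).
[cite: FischlerSprangZudilin2019, §4 Lemma 3 eq. (4.2) (second limit, consecutive j)] -/
theorem tendsto_ratio_succ {s D : ℕ} (hD : 1 ≤ D) (h3D : 3 * D ≤ s) {x₀ : ℝ} (hx₀ : 0 < x₀)
    (hf1 : fRatio s D x₀ = 1) (hlt : ∀ x, 0 < x → x < x₀ → 1 < fRatio s D x)
    (hgt : ∀ x, x₀ < x → fRatio s D x < 1) {j : ℕ} (hj : 1 ≤ j) (hjD : j + 1 ≤ D) :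
    Tendsto (fun n : ℕ => r s D n (j + 1) / r s D n j) atTop (𝓝 1) := by
  have hjD1 : j ≤ D := by omega
  have hj1 : 1 ≤ j + 1 := by omega
  obtain ⟨A, hA5, hAx, hAg⟩ := exists_A (s := s) hD h3D hx₀
  obtain ⟨B, hB, hbody⟩ := exists_body_bound (s := s) hD h3D A
  have hg := gRate_pos (s := s) hD hx₀.le
  have hLr : Lprof s D x₀ = Real.log (gRate s D x₀) := Lprof_root hD hx₀ hf1
  rw [Metric.tendsto_atTop]
  intro ε hε
  -- ε' and the window
  set ε' : ℝ := min (ε / 4) (1 / 4) with hε'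
  have hε'0 : 0 < ε' := lt_min (by linarith) (by norm_num)
  have hε'1 : ε' ≤ ε / 4 := min_le_left _ _
  have hε'2 : ε' ≤ 1 / 4 := min_le_right _ _
  obtain ⟨δ, hδ0, hδx, hδ1, N₁, hwin⟩ := window_ratio (s := s) hD hx₀ hf1 hε'0
  obtain ⟨η, hη0, hη1, hgap⟩ := Lprof_gap hD hx₀ hlt hgt hδ0 (by linarith)
  -- the off-window ratio: θ_n = T1 n + T2 n → 0
  set d : ℕ → ℝ := fun n => Lprof s D x₀ - Lprof s D ((⌊x₀ * n⌋₊ : ℝ) / n) with hd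
  clear_value d
  have hd0 : Tendsto d atTop (𝓝 0) := by
    have := (tendsto_Lprof_floor s D hx₀.le).const_sub (Lprof s D x₀)
    rw [sub_self] at this
    rw [hd]
    exact this
  have hT := (tendsto_exp_form hd0 hη0 (2 * B + 1) ((A : ℝ) + 1)).add
    (tendsto_exp_form hd0 (Real.log_pos one_lt_two) B 2)
  rw [add_zero] at hT
  obtain ⟨N₂, hN₂⟩ := eventually_atTop.1 (hT.eventually (Iio_mem_nhds hε'0))
  refine ⟨max (max N₁ N₂) 1, fun n hn => ?_⟩
  have hn1 : 1 ≤ n := le_trans (le_max_right _ _) hn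
  have hnN₁ : N₁ ≤ n := le_trans ((le_max_left _ _).trans (le_max_left _ _)) hn
  have hnN₂ : N₂ ≤ n := le_trans ((le_max_right _ _).trans (le_max_left _ _)) hn
  have hn' : (1 : ℝ) ≤ n := by exact_mod_cast hn1
  have hln0 : 0 ≤ Real.log ((n : ℝ) + 1) := Real.log_nonneg (by linarith)
  -- θ_n
  set θ : ℝ := ((A : ℝ) + 1) * Real.exp (n * (-η + d n) + (2 * B + 1) * (1 + Real.log ((n : ℝ) + 1))) +
    2 * Real.exp (n * (-Real.log 2 + d n) + B * (1 + Real.log ((n : ℝ) + 1))) with hθ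
  have hθε : θ < ε' := hN₂ n hnN₂
  have hθ0 : 0 ≤ θ := by rw [hθ]; positivity
  clear_value θ
  -- lower bound m_n of r_{n,i}
  set m : ℝ := Real.exp (n * Lprof s D ((⌊x₀ * n⌋₊ : ℝ) / n) - B * (1 + Real.log ((n : ℝ) + 1))) with hm
  have hm_pos : 0 < m := Real.exp_pos _
  have hm_le : ∀ i : ℕ, 1 ≤ i → i ≤ D → m ≤ r s D n i := by
    intro i hi hiD
    have hk := floor_le_mul hx₀.le hAx n
    have h := (cR_exp_bounds hn1 hi hiD (hbody n _ i hn1 hi hiD hk)).2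
    refine h.trans ?_
    rw [r_eq_tsum_cR hD h3D hn1 hi hiD]
    exact (summable_cR hD h3D hn1 hi hiD).le_tsum _ (fun k _ => (cR_pos hn1 hi hiD k).le)
  -- the decomposition r = W + O with O ≤ θ m
  set inwin : ℕ → Prop := fun k => (x₀ - δ) * n ≤ k ∧ (k : ℝ) ≤ (x₀ + δ) * n with hinwin
  set W : ℕ → ℝ := fun i => ∑ k ∈ range (A * n + 1) with inwin k, cR s D n i k with hW
  set O : ℕ → ℝ := fun i => (∑ k ∈ range (A * n + 1) with ¬inwin k, cR s D n i k) +
    ∑' q : ℕ, cR s D n i (q + (A * n + 1)) with hO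
  clear_value W O
  have hrWO : ∀ i : ℕ, 1 ≤ i → i ≤ D → r s D n i = W i + O i := by
    intro i hi hiD
    rw [hW, hO]
    simp only
    rw [r_eq_sum_add_tail hD h3D hn1 hi hiD (A * n + 1), ← add_assoc, sum_filter_add_sum_filter_not]
  have hO0 : ∀ i : ℕ, 1 ≤ i → i ≤ D → 0 ≤ O i := fun i hi hiD => by
    rw [hO]
    exact add_nonneg (sum_nonneg fun k _ => (cR_pos hn1 hi hiD k).le)
      (tsum_nonneg fun q => (cR_pos hn1 hi hiD _).le)
  have hO_le : ∀ i : ℕ, 1 ≤ i → i ≤ D → O i ≤ θ * m := by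
    intro i hi hiD
    -- non-window body terms
    have hterm : ∀ k ∈ (range (A * n + 1)).filter (fun k => ¬inwin k),
        cR s D n i k ≤ Real.exp (n * (Lprof s D x₀ - η) + B * (1 + Real.log ((n : ℝ) + 1))) := by
      intro k hk
      simp only [Finset.mem_filter, Finset.mem_range, hinwin, not_and_or, not_le] at hk
      obtain ⟨hkA, hkw⟩ := hk
      have hkA' : k ≤ A * n := by omega
      have h1 := (cR_exp_bounds hn1 hi hiD (hbody n k i hn1 hi hiD hkA')).1
      have hdist : δ ≤ |(k : ℝ) / n - x₀| := by
        have hnpos : (0 : ℝ) < n := by linarith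
        rcases hkw with h | h
        · have : (k : ℝ) / n < x₀ - δ := by rw [div_lt_iff₀ hnpos]; linarith
          rw [abs_of_neg (by linarith)]; linarith
        · have : x₀ + δ < (k : ℝ) / n := by rw [lt_div_iff₀ hnpos]; linarith
          rw [abs_of_pos (by linarith)]; linarith
      have hL := hgap ((k : ℝ) / n) (by positivity) hdist
      calc cR s D n i k ≤ Real.exp (n * Lprof s D ((k : ℝ) / n) + B * (1 + Real.log ((n : ℝ) + 1))) := h1
        _ ≤ Real.exp (n * (Lprof s D x₀ - η) + B * (1 + Real.log ((n : ℝ) + 1))) := by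
            apply Real.exp_le_exp.2
            have := mul_le_mul_of_nonneg_left hL (by positivity : (0 : ℝ) ≤ n)
            linarith
    have hsum : ∑ k ∈ range (A * n + 1) with ¬inwin k, cR s D n i k ≤
        ((A * n + 1 : ℕ) : ℝ) * Real.exp (n * (Lprof s D x₀ - η) + B * (1 + Real.log ((n : ℝ) + 1))) := by
      refine (sum_le_card_nsmul _ _ _ hterm).trans ?_
      rw [nsmul_eq_mul]
      refine mul_le_mul_of_nonneg_right ?_ (by positivity)
      exact_mod_cast (Finset.card_filter_le _ _).trans (Finset.card_range _).le
    have htail := tsum_tail_le_geom (n := n) hD h3D hn1 hi hiD hA5 hAg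
    -- rewrite both against m
    have hAn1 : ((A * n + 1 : ℕ) : ℝ) ≤ ((A : ℝ) + 1) * Real.exp (Real.log ((n : ℝ) + 1)) := by
      rw [Real.exp_log (by linarith)]; push_cast; nlinarith
    have e1 : ((A : ℝ) + 1) * Real.exp (Real.log ((n : ℝ) + 1)) *
        Real.exp (n * (Lprof s D x₀ - η) + B * (1 + Real.log ((n : ℝ) + 1))) ≤
        ((A : ℝ) + 1) * Real.exp (n * (-η + d n) + (2 * B + 1) * (1 + Real.log ((n : ℝ) + 1))) * m := by
      rw [hm, mul_assoc, mul_assoc, ← Real.exp_add, ← Real.exp_add]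
      refine mul_le_mul_of_nonneg_left (Real.exp_le_exp.2 ?_) (by positivity)
      rw [hd]
      nlinarith
    have e2 : 2 * (gRate s D x₀ / 2) ^ n =
        2 * Real.exp (n * (-Real.log 2 + d n) + B * (1 + Real.log ((n : ℝ) + 1))) * m := by
      rw [hm, mul_assoc, ← Real.exp_add, hd, hLr]
      congr 1
      rw [show (n : ℝ) * (-Real.log 2 + (Real.log (gRate s D x₀) - Lprof s D ((⌊x₀ * n⌋₊ : ℝ) / n))) +
          B * (1 + Real.log ((n : ℝ) + 1)) +
          (n * Lprof s D ((⌊x₀ * n⌋₊ : ℝ) / n) - B * (1 + Real.log ((n : ℝ) + 1))) =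
          n * (Real.log (gRate s D x₀) - Real.log 2) by ring,
        ← Real.log_div hg.ne' two_ne_zero, Real.exp_nat_mul, Real.exp_log (by positivity)]
    rw [hO]
    calc (∑ k ∈ range (A * n + 1) with ¬inwin k, cR s D n i k) + ∑' q : ℕ, cR s D n i (q + (A * n + 1))
        ≤ ((A * n + 1 : ℕ) : ℝ) * Real.exp (n * (Lprof s D x₀ - η) + B * (1 + Real.log ((n : ℝ) + 1))) +
          2 * (gRate s D x₀ / 2) ^ n := add_le_add hsum htail
      _ ≤ ((A : ℝ) + 1) * Real.exp (Real.log ((n : ℝ) + 1)) *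
            Real.exp (n * (Lprof s D x₀ - η) + B * (1 + Real.log ((n : ℝ) + 1))) +
          2 * (gRate s D x₀ / 2) ^ n := by gcongr
      _ ≤ ((A : ℝ) + 1) * Real.exp (n * (-η + d n) + (2 * B + 1) * (1 + Real.log ((n : ℝ) + 1))) * m +
          2 * Real.exp (n * (-Real.log 2 + d n) + B * (1 + Real.log ((n : ℝ) + 1))) * m := by
          rw [← e2]; gcongr
      _ = θ * m := by rw [hθ]; ring
  clear_value m
  -- consequences for i = j and i = j + 1
  have hrj := hrWO j hj hjD1
  have hrj1 := hrWO (j + 1) hj1 hjD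
  have hOj := hO_le j hj hjD1
  have hOj1 := hO_le (j + 1) hj1 hjD
  have hmj := hm_le j hj hjD1
  have hmj1 := hm_le (j + 1) hj1 hjD
  have hOj0 := hO0 j hj hjD1
  have hOj10 := hO0 (j + 1) hj1 hjD
  -- window comparison
  have hterm2 : ∀ k ∈ (range (A * n + 1)).filter (fun k => inwin k),
      (1 - ε') * cR s D n j k ≤ cR s D n (j + 1) k ∧ cR s D n (j + 1) k ≤ (1 + ε') * cR s D n j k := by
    intro k hk
    simp only [Finset.mem_filter, hinwin] at hk
    obtain ⟨-, hk1, hk2⟩ := hk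
    have h := hwin n hnN₁ k hk1 hk2 j hj hjD
    have hc := cR_pos (s := s) hn1 hj hjD1 k
    rw [abs_le] at h
    obtain ⟨h1, h2⟩ := h
    rw [le_sub_iff_add_le, le_div_iff₀ hc] at h1
    rw [sub_le_iff_le_add, div_le_iff₀ hc] at h2
    constructor <;> linarith
  have hWcmp : (1 - ε') * W j ≤ W (j + 1) ∧ W (j + 1) ≤ (1 + ε') * W j := by
    rw [hW]
    simp only
    rw [mul_sum, mul_sum]
    exact ⟨sum_le_sum fun k hk => (hterm2 k hk).1, sum_le_sum fun k hk => (hterm2 k hk).2⟩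
  have hrjpos := r_pos' hD h3D hn1 hj hjD1
  have hrj1pos := r_pos' hD h3D hn1 hj1 hjD
  set rj := r s D n j with hrj_def
  set rj1 := r s D n (j + 1) with hrj1_def
  clear_value rj rj1
  set Wj := W j with hWj
  set Wj1 := W (j + 1) with hWj1
  set Oj := O j with hOjd
  set Oj1 := O (j + 1) with hOj1d
  clear_value Wj Wj1 Oj Oj1
  -- linear consequences
  have hOj' : Oj ≤ ε' * rj := by
    have := mul_le_mul hθε.le hmj hm_pos.le hε'0.le
    linarith [hOj]
  have hOj1' : Oj1 ≤ ε' * rj1 := by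
    have := mul_le_mul hθε.le hmj1 hm_pos.le hε'0.le
    linarith [hOj1]
  have hWj_ge : (1 - ε') * rj ≤ Wj := by linarith [hrj, hOj']
  have hWj_le : Wj ≤ rj := by linarith [hrj, hOj0]
  have hε'3 : 0 ≤ 1 - ε' := by linarith
  rw [Real.dist_eq, abs_lt]
  constructor
  · -- lower: r_{j+1} ≥ W_{j+1} ≥ (1-ε') W_j ≥ (1-ε')² r_j > (1-ε) r_j
    have h1 : (1 - ε') * ((1 - ε') * rj) ≤ (1 - ε') * Wj := mul_le_mul_of_nonneg_left hWj_ge hε'3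
    have h2 : Wj1 ≤ rj1 := by linarith [hrj1, hOj10]
    have h3 : 0 ≤ ε' * (ε' * rj) := by positivity
    have h4 : ε' * rj ≤ ε / 4 * rj := mul_le_mul_of_nonneg_right hε'1 hrjpos.le
    have h5 : 0 < ε * rj := mul_pos hε hrjpos
    rw [lt_sub_iff_add_lt, lt_div_iff₀ hrjpos]
    linarith [hWcmp.1, h1, h2, h3, h4, h5]
  · -- upper: (1-ε') r_{j+1} ≤ W_{j+1} ≤ (1+ε') W_j ≤ (1+ε') r_j, and (1+ε')/(1-ε') ≤ 1 + 3ε'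
    have h1 : (1 + ε') * Wj ≤ (1 + ε') * rj := mul_le_mul_of_nonneg_left hWj_le (by linarith)
    have hA : (1 - ε') * rj1 ≤ (1 + ε') * rj := by linarith [hrj1, hWcmp.2, h1, hOj1']
    have h3 : ε' * ε' ≤ 1 / 4 * ε' := mul_le_mul_of_nonneg_right hε'2 hε'0.le
    have h4 : ε' * ε' * rj ≤ 1 / 4 * ε' * rj := mul_le_mul_of_nonneg_right h3 hrjpos.le
    have h5 : 0 ≤ ε' * rj := by positivity
    have hB : (1 + ε') * rj ≤ (1 - ε') * ((1 + 3 * ε') * rj) := by linarith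
    have hC : rj1 ≤ (1 + 3 * ε') * rj := le_of_mul_le_mul_left (hA.trans hB) (by linarith)
    have h6 : ε' * rj ≤ ε / 4 * rj := mul_le_mul_of_nonneg_right hε'1 hrjpos.le
    have h7 : 0 < ε * rj := mul_pos hε hrjpos
    rw [sub_lt_iff_lt_add, div_lt_iff₀ hrjpos]
    linarith

/-- **`r_{n,j}/r_{n,1} → 1`** for every `1 ≤ j ≤ D`. [cite: FischlerSprangZudilin2019, §4 Lemma 3 eq. (4.2) (second limit)] -/
theorem tendsto_ratio_one {s D : ℕ} (hD : 1 ≤ D) (h3D : 3 * D ≤ s) {x₀ : ℝ} (hx₀ : 0 < x₀)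
    (hf1 : fRatio s D x₀ = 1) (hlt : ∀ x, 0 < x → x < x₀ → 1 < fRatio s D x)
    (hgt : ∀ x, x₀ < x → fRatio s D x < 1) {j : ℕ} (hj : 1 ≤ j) (hjD : j ≤ D) :
    Tendsto (fun n : ℕ => r s D n j / r s D n 1) atTop (𝓝 1) := by
  induction j, hj using Nat.le_induction with
  | base =>
    refine tendsto_const_nhds.congr' ?_
    filter_upwards [eventually_ge_atTop 1] with n hn
    rw [div_self (r_pos' hD h3D hn le_rfl hD).ne']
  | succ j hj ih =>
    have h1 := tendsto_ratio_succ hD h3D hx₀ hf1 hlt hgt hj hjD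
    have h2 := ih (by omega)
    have h := h1.mul h2
    rw [one_mul] at h
    refine h.congr' ?_
    filter_upwards [eventually_ge_atTop 1] with n hn
    have := (r_pos' hD h3D hn hj (by omega)).ne'
    field_simp

/-- **`r_{n,j'}/r_{n,j} → 1`** for all `j, j' ∈ {1, …, D}` — the second limit of (4.2).
[cite: FischlerSprangZudilin2019, §4 Lemma 3 eq. (4.2) ("lim r_{n,j'}/r_{n,j} = 1 for any j, j'")] -/
theorem tendsto_ratio {s D : ℕ} (hD : 1 ≤ D) (h3D : 3 * D ≤ s) {x₀ : ℝ} (hx₀ : 0 < x₀)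
    (hf1 : fRatio s D x₀ = 1) (hlt : ∀ x, 0 < x → x < x₀ → 1 < fRatio s D x)
    (hgt : ∀ x, x₀ < x → fRatio s D x < 1) {j j' : ℕ} (hj : 1 ≤ j) (hjD : j ≤ D) (hj' : 1 ≤ j')
    (hj'D : j' ≤ D) :
    Tendsto (fun n : ℕ => r s D n j' / r s D n j) atTop (𝓝 1) := by
  have h1 := tendsto_ratio_one hD h3D hx₀ hf1 hlt hgt hj' hj'D
  have h2 := tendsto_ratio_one hD h3D hx₀ hf1 hlt hgt hj hjD
  have h := h1.div h2 one_ne_zero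
  rw [div_one] at h
  refine h.congr' ?_
  filter_upwards [eventually_ge_atTop 1] with n hn
  have h0 := (r_pos' hD h3D hn le_rfl hD).ne'
  have hj0 := (r_pos' hD h3D hn hj hjD).ne'
  simp only [Pi.div_apply]
  field_simp

end Lemma3

/-! ### Lemma 3 -/

open Lemma3 in
/-- **Lemma 3 of Fischler–Sprang–Zudilin 2019, PROVED** (discharging the named fact `lemma3` of
`Asymptotics.lean`, with the absolute constant `C₀ = 100`): for `D ≥ 2`, `s ≥ 3D` odd and
`100 · D log D ≤ s`, the polynomial `(X+3)^D(X+1)^{s+1} - X^D(X+2)^{s+1}` has a unique positive root `x₀`,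
`g(x₀) < 3^{-(s+1)}`, `lim_n r_{n,j}^{1/n} = g(x₀)` and `lim_n r_{n,j'}/r_{n,j} = 1` for all `j, j' ∈ {1,…,D}`.
[cite: FischlerSprangZudilin2019, §4 Lemma 3] -/
theorem lemma3_holds : lemma3 := by
  refine ⟨100, fun s D _ h3D hD2 hC => ?_⟩
  have hD : 1 ≤ D := le_trans (by norm_num) hD2
  obtain ⟨x₀, hx₀, hf1, hlt, hgt⟩ := exists_root (s := s) hD h3D
  refine ⟨x₀, hx₀, (eval_rootPoly_eq_zero_iff hx₀).2 hf1,
    fun x hx h => root_unique hlt hgt hx ((eval_rootPoly_eq_zero_iff hx).1 h),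
    gRate_root_lt hD2 hC hx₀ hf1 hlt,
    fun j hj hjD => tendsto_r_rpow hD h3D hx₀ hf1 hlt hgt hj hjD,
    fun j j' hj hjD hj' hj'D => tendsto_ratio hD h3D hx₀ hf1 hlt hgt hj hjD hj' hj'D⟩

end Literature.NumberTheory.Irrationality.FischlerSprangZudilin2019
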